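import Summits.ResolutionOfSingularities.ResolutionOfSingularities.Theorems.MarkedTransferCampaignW46ThreefoldsCurveSliceClosedPoints
import Summits.ResolutionOfSingularities.ResolutionOfSingularities.Theorems.MarkedTransferCampaignW46ThreefoldsGammaFreeGlobalStrictTransform
import Literature.AlgebraicGeometry.Resolution.HironakaTauTransport
import Literature.AlgebraicGeometry.Resolution.AlterationsNormalFormStrictTransform
import Literature.AlgebraicGeometry.Resolution.CurveCentreTwoParameters
import HarnessLib

/-!
# [OURS · L1 W4.6 rung (ii-τ2)] Σ-REGULARISATION UNDER `τ ≥ 2`, THE STEP — blowing up a singular point of an integral curve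
# `Σ = {ord = μ}` whose closed points have `τ ≥ 2`: the new `Σ` is the strict transform, the invariants persist, `Σ δ` drops

Cell res-hironaka, LADDER-RESOLUTION rung L (D-0089), slot W4.6, rung (ii) (threefold hypersurfaces); seat res-L1-s46-pv-3
(gen 4). Host route MarkedTransfer, host item `HypersurfaceOrderReductionDimLeThree` (stmt-ResolutionOfSingularities-16156);
filed `--supports` it `--as helper`. This is step 1 of the algorithm of Cossart–Piltant 2008, Prop. 4.4 («if `Σ(i)` has an
irreducible component of dimension one which is singular, let `X(i+1)` be the blowing up along any such singular point»)
in the `τ ≥ 2` branch, as OURS scheme theory over PROVED tree lemmas: the near-point theory (Lemma 4.3, p514195 / p518139),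
the `τ`-transport off the centre (p519265), and the `δ`-bookkeeping of the strict transform of an integral curve under a point
blow-up (res-L1-s46-pv-11's brick B8b `exists_strictTransform_pointBlowup`, p504114; Liu 9.2.32 / Kollár §1.4). Nothing of
H. Hironaka's manuscript is asserted. AI-written; AI review is weaker than expert review.

## What is proved (one proof-device structure, no OURS statement)

* `CampaignW46.SigmaCurveState X₀ J₀ μ` — PROOF DEVICE: a stage `(X, J, Φ)` of a sequence of permissible blowing-ups of
  `(X₀, J₀, μ)` with a closed immersion `i : C ↪ X` of an integral Noetherian quasi-excellent curve PRESENTING the order-`μ` locus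
  (`{ord ≥ μ} = i(C)`, `ord ≤ μ`, `i(η_C)` not closed, of coheight `> 1`), whose closed points are threefold points with `τ ≥ 2`;
  measure `Σ_y δ(𝒪_{C,y})`. `….isClosed_apply` — the non-generic points of `C` are closed points of `X`.
* `CampaignW46.SigmaCurveState.exists_step_of_not_mem_regularLocus` — **THE STEP**: for a SINGULAR `c ∈ C`, blowing up
  `x = i(c)` (a `τ = 2` point: not isolated in `Σ`, p518139) gives a new stage whose order-`μ` locus is the strict transform `C₁`
  of `C` (off the fibre by the isomorphism; over `x` the only point of order `μ` is THE near point, on `C₁`), the invariants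
  persisting (`τ`: monotonicity at the near point, transport p519265 elsewhere), and `Σ δ(C₁) < Σ δ(C)`.

References: p504114 (B8b), p515229, p520244; tree `NearPointsPointCentreUnique.lean` (p514195), `NearPointsSigmaLocal.lean` (p518139),
`HironakaTauTransport.lean` (p519265), `NearPointTauMonotone.lean` [CossartPiltant2008, Lemma 4.3; proof of Prop. 4.4],
`QuasiExcellentCurveDelta.lean` [Liu2002, §9.2.4]. H. Hironaka, ms. 2017-03-23 — scope only, not cited as fact. [Hironaka2017]
-/

noncomputable section

set_option linter.dupNamespace false -- mandated namespace of this single-conjunct summit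

open CategoryTheory AlgebraicGeometry TopologicalSpace IsLocalRing

namespace Summit.ResolutionOfSingularities.ResolutionOfSingularities.Theorems

namespace CampaignW46

open Literature.AlgebraicGeometry.Resolution
open Scheme.IdealSheafData
open Literature.AlgebraicGeometry.Hironaka2017

universe u

/-! ## §0 Plumbing -/

/-- Along an isomorphism of local rings the embedding dimension is preserved. [folklore] -/
theorem spanFinrank_eq_of_isIso_stalkMap {X X' : Scheme.{u}} (π : X' ⟶ X) (x' : X') [IsIso (π.stalkMap x')] :
    (maximalIdeal (X'.presheaf.stalk x')).spanFinrank = (maximalIdeal (X.presheaf.stalk (π x'))).spanFinrank := by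
  let e : X.presheaf.stalk (π x') ≃+* X'.presheaf.stalk x' := (asIso (π.stalkMap x')).commRingCatIsoToRingEquiv
  rw [← map_ringEquiv_maximalIdeal e, Ideal.spanFinrank_map_eq_of_ringEquiv]

/-- Along an isomorphism of local rings the coheight (`= dim 𝒪`) is preserved. [folklore] -/
theorem coheight_eq_of_isIso_stalkMap {X X' : Scheme.{u}} (π : X' ⟶ X) (x' : X') [IsIso (π.stalkMap x')] :
    Order.coheight x' = Order.coheight (π x') := by
  let e : X.presheaf.stalk (π x') ≃+* X'.presheaf.stalk x' := (asIso (π.stalkMap x')).commRingCatIsoToRingEquiv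
  have h := ringKrullDim_eq_of_ringEquiv e
  rw [ringKrullDim_stalk_eq_coheight, ringKrullDim_stalk_eq_coheight] at h
  exact_mod_cast h.symm

/-- **A blowing up is injective off its centre.** [cite: GortzWedhorn2020, Prop. 13.91 (3)] -/
theorem IsBlowup.eq_of_apply_eq_of_not_mem {X X' : Scheme.{u}} {π : X' ⟶ X} {C : X.IdealSheafData}
    (hπ : IsBlowup π C) {z₁ z₂ : X'} (h : π z₁ = π z₂) (hz : π z₁ ∉ (C.support : Set X)) : z₁ = z₂ := by
  set W : X.Opens := ⟨(C.support : Set X)ᶜ, C.support.isClosed.isOpen_compl⟩ with hW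
  haveI : IsIso (π ∣_ W) := hπ.isIso_compl
  have hz₁ : z₁ ∈ π ⁻¹ᵁ W := hz
  have hz₂ : z₂ ∈ π ⁻¹ᵁ W := by change π z₂ ∈ (C.support : Set X)ᶜ; rw [← h]; exact hz
  have hinj := (ConcreteCategory.bijective_of_isIso ((π ∣_ W).base)).1
  have key : (⟨z₁, hz₁⟩ : ↥(π ⁻¹ᵁ W)) = ⟨z₂, hz₂⟩ := by
    apply hinj
    apply Subtype.ext
    rw [morphismRestrict_base_coe, morphismRestrict_base_coe]
    exact h
  exact congrArg Subtype.val key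

/-- For a regular local ring of a scheme, `coheight = emb.dim` (both equal `dim 𝒪`). [folklore] -/
theorem coheight_eq_spanFinrank {X : Scheme.{u}} (x : X) [IsRegularLocalRing (X.presheaf.stalk x)] :
    Order.coheight x = (maximalIdeal (X.presheaf.stalk x)).spanFinrank := by
  have h1 := ringKrullDim_stalk_eq_coheight x
  have h2 := IsRegularLocalRing.spanFinrank_maximalIdeal (R := X.presheaf.stalk x)
  rw [← h2] at h1
  exact_mod_cast h1.symm

/-! ## §1 The state (proof device) -/

/-- PROOF DEVICE (not an OURS notion, no role of the manuscript): **a stage of the Σ-regularisation of an integral order-`μ`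
curve under `τ ≥ 2`.** Over the fixed `(X₀, J₀, μ)`: a quasi-compact regular locally Noetherian stage `X` of a sequence of
permissible blowing-ups `Φ : X ⟶ X₀` for `(J₀, μ)` with last transform `J`, whose locus of order `≥ μ` IS the image of a closed
immersion `i : C ↪ X` of an integral Noetherian quasi-excellent scheme of dimension `≤ 1` — a genuine curve of codimension `2`
(`i(η_C)` is not closed, of coheight `> 1`) — with `ord ≤ μ` everywhere, and whose CLOSED points have embedding dimension `3` and
Hironaka `τ ≥ 2`. [cite: CossartPiltant2008, proof of Prop. 4.4] -/
structure SigmaCurveState (X₀ : Scheme.{u}) (J₀ : X₀.IdealSheafData) (μ : ℕ) where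
  /-- the stage `X_n` -/
  X : Scheme.{u}
  /-- the transform `J_n` -/
  J : X.IdealSheafData
  /-- the structure morphism `X_n ⟶ X_0` -/
  Φ : X ⟶ X₀
  /-- `X_n` is locally Noetherian -/
  locNoeth : IsLocallyNoetherian X
  /-- `X_n` is quasi-compact -/
  cpt : CompactSpace X
  /-- `X_n` is regular -/
  reg : Scheme.IsRegular X
  /-- `Φ` is a sequence of permissible blowing-ups for `(J₀, μ)` with last transform `J_n` -/
  seq : IsPermissibleBlowupSeq J₀ μ Φ J
  /-- the curve `C_n` -/
  C : Scheme.{u}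
  /-- its embedding -/
  i : C ⟶ X
  /-- `i` is a closed immersion -/
  ci : IsClosedImmersion i
  /-- `C_n` is integral -/
  int : IsIntegral C
  /-- `C_n` is Noetherian -/
  noeth : IsNoetherian C
  /-- `C_n` is quasi-excellent -/
  qe : Scheme.IsQuasiExcellent C
  /-- `C_n` has dimension `≤ 1` -/
  dimC : topologicalKrullDim C ≤ 1
  /-- the generic point of the curve is not a closed point of `X_n` -/
  notClosed : ¬ IsClosed ({i (genericPoint C)} : Set X)
  /-- the curve has codimension `2`: the coheight of its generic point exceeds `1` -/
  coh : 1 < Order.coheight (i (genericPoint C))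
  /-- the locus of order `≥ μ` is `i(C)` -/
  sigma : ∀ z : X, (μ : ℕ∞) ≤ idealOrder J z ↔ z ∈ Set.range i
  /-- `μ` is the maximal order -/
  top : ∀ z : X, idealOrder J z ≤ μ
  /-- the closed points of `Σ` are threefold points -/
  dim3 : ∀ z ∈ Set.range i, IsClosed ({z} : Set X) → (maximalIdeal (X.presheaf.stalk z)).spanFinrank = 3
  /-- the closed points of `Σ` have `τ ≥ 2` -/
  tau : ∀ z ∈ Set.range i, IsClosed ({z} : Set X) → haveI := reg z; 2 ≤ stalkTau J z μ

namespace SigmaCurveState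

variable {X₀ : Scheme.{u}} {J₀ : X₀.IdealSheafData} {μ : ℕ}

/-- The measure: the total `δ`-invariant of the curve. [cite: Liu2002, §9.2.4 Lemma 2.32] -/
def delta (σ : SigmaCurveState X₀ J₀ μ) : ℕ∞ :=
  haveI := σ.int; ∑ᶠ y, pointDelta σ.C y

/-- `i(η_C) ⤳ i(c)` for every `c`. [folklore] -/
theorem generic_specializes (σ : SigmaCurveState X₀ J₀ μ) (c : σ.C) :
    haveI := σ.int; σ.i (genericPoint σ.C) ⤳ σ.i c := by
  haveI := σ.int
  exact (genericPoint_specializes c).map σ.i.continuous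

/-- `Σ = i(C)` is closed. [folklore] -/
theorem isClosed_range (σ : SigmaCurveState X₀ J₀ μ) : IsClosed (Set.range σ.i) := by
  haveI := σ.ci
  exact σ.i.isClosedEmbedding.isClosed_range

/-- **The images of the non-generic points of the curve are closed points of `X`** (coheights: a closed specialization `z`
of `i(c)` inside `Σ` has `coheight z = 3`, while `coheight i(c) ≥ coheight i(η) + 1 ≥ 3`; a strict specialization would raise the
coheight above `3`). [folklore] -/
theorem isClosed_apply (σ : SigmaCurveState X₀ J₀ μ) {c : σ.C} (hc : haveI := σ.int; c ≠ genericPoint σ.C) :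
    IsClosed ({σ.i c} : Set σ.X) := by
  haveI := σ.int
  haveI := σ.ci
  haveI := σ.cpt
  have hX := σ.reg
  -- a closed specialization `z` of `i c`, inside `Σ`, of coheight `3`
  obtain ⟨z, hsp, hzc⟩ := exists_specializes_isClosed (σ.i c)
  have hzS : z ∈ Set.range σ.i := hsp.mem_closed σ.isClosed_range ⟨c, rfl⟩
  haveI : IsRegularLocalRing (σ.X.presheaf.stalk z) := hX z
  haveI : IsRegularLocalRing (σ.X.presheaf.stalk (σ.i c)) := hX _
  haveI : IsRegularLocalRing (σ.X.presheaf.stalk (σ.i (genericPoint σ.C))) := hX _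
  have hz3 : Order.coheight z = 3 := by rw [coheight_eq_spanFinrank z, σ.dim3 z hzS hzc]; rfl
  -- `coheight (i c) ≥ 3`
  have hηc : σ.i (genericPoint σ.C) ≠ σ.i c := fun h => hc (σ.i.isClosedEmbedding.injective h).symm
  have hlt₁ : σ.i c < σ.i (genericPoint σ.C) := by
    refine ⟨σ.generic_specializes c, fun h => hηc ?_⟩
    exact ((σ.generic_specializes c).antisymm h).eq
  have hfinη : Order.coheight (σ.i (genericPoint σ.C)) < ⊤ := by
    rw [coheight_eq_spanFinrank]; exact ENat.coe_lt_top _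
  have h3c : (3 : ℕ∞) ≤ Order.coheight (σ.i c) := by
    have h := Order.coheight_strictAnti hlt₁ hfinη
    have h2 : (2 : ℕ∞) ≤ Order.coheight (σ.i (genericPoint σ.C)) := Order.add_one_le_of_lt σ.coh
    exact Order.add_one_le_of_lt (lt_of_le_of_lt h2 h)
  -- hence `i c = z`
  by_contra hne
  have hne' : σ.i c ≠ z := fun h => hne (h ▸ hzc)
  have hlt₂ : z < σ.i c := by
    refine ⟨hsp, fun h => hne' ?_⟩
    exact (hsp.antisymm h).eq
  have hfinc : Order.coheight (σ.i c) < ⊤ := by rw [coheight_eq_spanFinrank]; exact ENat.coe_lt_top _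
  have h := Order.coheight_strictAnti hlt₂ hfinc
  rw [hz3] at h
  exact absurd (lt_of_le_of_lt h3c h) (lt_irrefl _)

/-- `ord_z J = μ` on `Σ`. [folklore] -/
theorem idealOrder_eq (σ : SigmaCurveState X₀ J₀ μ) {z : σ.X} (hz : z ∈ Set.range σ.i) : idealOrder σ.J z = μ :=
  le_antisymm (σ.top z) ((σ.sigma z).mpr hz)

/-- The generic point of the curve is regular, so a point outside the regular locus is not the generic point. [folklore] -/
theorem ne_genericPoint_of_not_mem_regularLocus (σ : SigmaCurveState X₀ J₀ μ) {c : σ.C}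
    (hc : c ∉ Scheme.regularLocus σ.C) : haveI := σ.int; c ≠ genericPoint σ.C := by
  haveI := σ.int
  rintro rfl
  apply hc
  change IsRegularLocalRing (σ.C.presheaf.stalk (genericPoint σ.C))
  haveI : IsNoetherianRing (σ.C.presheaf.stalk (genericPoint σ.C)) := by
    haveI := σ.noeth; haveI : IsLocallyNoetherian σ.C := inferInstance; infer_instance
  letI : Field (σ.C.presheaf.stalk (genericPoint σ.C)) := inferInstanceAs (Field σ.C.functionField)
  infer_instance

set_option maxHeartbeats 1600000 in
-- a long assembly: the near-point theory, the strict transform and the transport lemmas at the new stage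
/-- **THE STEP OF THE Σ-REGULARISATION** (Cossart–Piltant 2008, proof of Prop. 4.4, step 1, in the `τ ≥ 2` branch). `X₀`
regular locally Noetherian, `μ ≥ 1`. For a stage `σ` and a SINGULAR point `c` of the curve `C`: `x = i(c)` is a closed `τ = 2` point of
order `μ` (not isolated in `Σ`, so `τ ≠ 3`, p518139); blowing it up, the locus of order `≥ μ` upstairs is the strict transform
`C₁` of `C` (p504114) — off the fibre by the isomorphism, over `x` because the only point of order `μ` is THE near point (p514195),
through which `C₁` passes — and the invariants persist (`ord ≤ μ`; threefold points with `τ ≥ 2`: at the near point by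
Lemma 4.3 (3), elsewhere by transport p519265); and `Σ δ(C₁) < Σ δ(C)` since `c` was singular.
[cite: CossartPiltant2008, proof of Prop. 4.4] -/
theorem exists_step_of_not_mem_regularLocus (hm : 1 ≤ μ) (σ : SigmaCurveState X₀ J₀ μ) {c : σ.C}
    (hc : c ∉ Scheme.regularLocus σ.C) : ∃ σ' : SigmaCurveState X₀ J₀ μ, σ'.delta < σ.delta := by
  classical
  haveI := σ.locNoeth
  haveI := σ.cpt
  haveI := σ.ci
  haveI := σ.int
  haveI := σ.noeth
  have hX := σ.reg
  set x := σ.i c with hxdef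
  have hcη : c ≠ genericPoint σ.C := σ.ne_genericPoint_of_not_mem_regularLocus hc
  have hxc : IsClosed ({x} : Set σ.X) := σ.isClosed_apply hcη
  have hηx : σ.i (genericPoint σ.C) ≠ x := fun h => hcη (σ.i.isClosedEmbedding.injective h).symm
  have hxS : x ∈ Set.range σ.i := ⟨c, rfl⟩
  have hordx : idealOrder σ.J x = μ := σ.idealOrder_eq hxS
  haveI : IsRegularLocalRing (σ.X.presheaf.stalk x) := hX x
  have hdx : (maximalIdeal (σ.X.presheaf.stalk x)).spanFinrank = 3 := σ.dim3 x hxS hxc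
  have hτx2 : 2 ≤ stalkTau σ.J x μ := σ.tau x hxS hxc
  -- `τ(x) = 2`: `x` is not isolated in `Σ` (`i η ⤳ x`, `i η ≠ x`)
  have hτx : stalkTau σ.J x μ = 2 := by
    have hle : stalkTau σ.J x μ ≤ 3 := (stalkTau_le σ.J x μ).trans hdx.le
    rcases (show stalkTau σ.J x μ = 2 ∨ stalkTau σ.J x μ = 3 by omega) with h | h
    · exact h
    · exfalso
      exact hηx (eq_of_specializes_of_stalkTau_eq_three hX σ.J hxc hdx hordx h (σ.generic_specializes c)
        ((σ.sigma _).mpr ⟨_, rfl⟩))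
  -- the blowing up of `x`
  set D : Closeds σ.X := ⟨{x}, hxc⟩ with hDdef
  have hregD : Scheme.IsRegular (vanishingIdeal D).subscheme := isRegular_subscheme_vanishingIdeal_singleton hxc
  have hY : ∀ y ∈ (D : Set σ.X), idealOrder σ.J y = μ := fun y hy => by
    have hy' : y = x := hy
    rw [hy']; exact hordx
  have hYle : ∀ y ∈ (D : Set σ.X), (μ : ℕ∞) ≤ idealOrder σ.J y := fun y hy => (hY y hy).ge
  obtain ⟨X', π, hπ⟩ := exists_isBlowup σ.X (vanishingIdeal D)
  haveI : IsProper π := hπ.isProper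
  haveI : IsLocallyNoetherian X' := LocallyOfFiniteType.isLocallyNoetherian π
  haveI : CompactSpace X' := QuasiCompact.compactSpace_of_compactSpace π
  have hX' : Scheme.IsRegular X' := hπ.isRegular_of_isRegular_subscheme hX hregD
  set J' := controlledTransform π (vanishingIdeal D) σ.J μ with hJ'def
  have hseq' : IsPermissibleBlowupSeq J₀ μ (π ≫ σ.Φ) J' := σ.seq.blowup D π hregD hYle hπ
  have hsuppD : ((vanishingIdeal D).support : Set σ.X) = {x} := by
    rw [Scheme.IdealSheafData.coe_support_vanishingIdeal]; rfl
  -- the strict transform of the curve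
  obtain ⟨C₁, j, ρ, hcj, hcomm, hint₁, hnoeth₁, hqe₁, hdim₁, hprop, -, hgen, -, -, hlt⟩ :=
    exists_strictTransform_pointBlowup σ.i σ.qe σ.dimC hxc hηx hπ
  haveI := hcj
  haveI := hint₁
  haveI := hnoeth₁
  haveI := hprop
  have hcomm_pt : ∀ c₁ : C₁, π (j c₁) = σ.i (ρ c₁) := fun c₁ => by
    rw [← Scheme.Hom.comp_apply, hcomm, Scheme.Hom.comp_apply]
  have hρη : ρ (genericPoint C₁) = genericPoint σ.C := by
    apply σ.i.isClosedEmbedding.injective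
    rw [← hcomm_pt, hgen]
  -- `ρ` is onto (proper and dominant)
  haveI : IsDominant ρ := ⟨Dense.mono
    (show ({genericPoint σ.C} : Set σ.C) ⊆ Set.range ρ by rintro _ rfl; exact ⟨_, hρη⟩)
    (by rw [dense_iff_closure_eq, genericPoint_closure])⟩
  haveI : Surjective ρ := inferInstance
  -- orders upstairs: off the fibre unchanged, over `x` at most `μ`, along `j(C₁)` at least `μ`
  have hoff : ∀ z' : X', π z' ≠ x → idealOrder J' z' = idealOrder σ.J (π z') := fun z' hz' =>
    hπ.idealOrder_controlledTransform_of_not_mem σ.J μ (by rw [hsuppD]; exact hz')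
  have htop' : ∀ z' : X', idealOrder J' z' ≤ μ := by
    intro z'
    by_cases hz' : π z' = x
    · exact hπ.idealOrder_controlledTransform_le_of_mem hX hregD hY (by rw [hz']; rfl)
    · rw [hoff z' hz']; exact σ.top _
  have hgenord : (μ : ℕ∞) ≤ idealOrder J' (j (genericPoint C₁)) := by
    rw [hoff _ (by rw [hgen]; exact hηx), hgen]
    exact (σ.sigma _).mpr ⟨_, rfl⟩
  have hrange_ge : ∀ c₁ : C₁, (μ : ℕ∞) ≤ idealOrder J' (j c₁) := by
    intro c₁
    haveI : IsRegularLocalRing (X'.presheaf.stalk (j c₁)) := hX' _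
    exact hgenord.trans (idealOrder_le_of_specializes ((genericPoint_specializes c₁).map j.continuous) _)
  -- the near point over `x`: some point of `j(C₁)` lies over `x` and is near
  obtain ⟨c₁₀, hc₁₀⟩ := ρ.surjective c
  set x' := j c₁₀ with hx'def
  have hx' : π x' = x := by rw [hx'def, hcomm_pt, hc₁₀]
  have hnear' : IsNear π (vanishingIdeal D) σ.J μ x' :=
    isNear_iff.mpr (le_antisymm (htop' x') (hrange_ge c₁₀))
  -- the data of `x`, read at `π x'`
  haveI : IsRegularLocalRing (σ.X.presheaf.stalk (π x')) := hX (π x')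
  haveI : IsRegularLocalRing (X'.presheaf.stalk x') := hX' x'
  have hcl' : IsClosed ({π x'} : Set σ.X) := by rw [hx']; exact hxc
  have hDeq : D = ⟨{π x'}, hcl'⟩ := Closeds.ext (by rw [hDdef]; simp [hx'])
  have hd' : (maximalIdeal (σ.X.presheaf.stalk (π x'))).spanFinrank = 3 := by
    rw [spanFinrank_maximalIdeal_congr hx']; exact hdx
  obtain ⟨cc, hcc, hccY⟩ := exists_rsop_three hcl' hd'
  rw [← hDeq] at hccY
  have hτ' : stalkTau σ.J (π x') μ = 2 := by rw [stalkTau_congr hX σ.J μ hx']; exact hτx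
  have hnear_eq : ∀ z' : X', π z' = x → (μ : ℕ∞) ≤ idealOrder J' z' → z' = x' := by
    intro z' hz' hge
    have hnz : IsNear π (vanishingIdeal D) σ.J μ z' := isNear_iff.mpr (le_antisymm (htop' z') hge)
    exact hπ.eq_of_isNear_of_isNear_point hd' hcc hccY hτ' hnear' hnz (hz'.trans hx'.symm)
  -- `Σ' = j(C₁)`
  have hsigma' : ∀ z' : X', (μ : ℕ∞) ≤ idealOrder J' z' ↔ z' ∈ Set.range j := by
    intro z'
    constructor
    · intro hge
      by_cases hz' : π z' = x
      · exact ⟨c₁₀, (hnear_eq z' hz' hge).symm⟩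
      · have hge' : (μ : ℕ∞) ≤ idealOrder σ.J (π z') := by rwa [← hoff z' hz']
        obtain ⟨c₀, hc₀⟩ := (σ.sigma _).mp hge'
        obtain ⟨c₁, rfl⟩ := ρ.surjective c₀
        refine ⟨c₁, ?_⟩
        exact (IsBlowup.eq_of_apply_eq_of_not_mem hπ (z₁ := z') (z₂ := j c₁) (by rw [hcomm_pt, hc₀])
          (by rw [hsuppD]; exact hz')).symm
    · rintro ⟨c₁, rfl⟩
      exact hrange_ge c₁
  -- the invariants at the closed points of `Σ'`
  have hnotClosed' : ¬ IsClosed ({j (genericPoint C₁)} : Set X') := by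
    intro hcl
    apply σ.notClosed
    have h := π.isClosedMap _ hcl
    rwa [Set.image_singleton, hgen] at h
  set W : σ.X.Opens := ⟨((vanishingIdeal D).support : Set σ.X)ᶜ, (vanishingIdeal D).support.isClosed.isOpen_compl⟩
    with hWdef
  haveI : IsIso (π ∣_ W) := hπ.isIso_compl
  have hoffx : ∀ z' : X', π z' ≠ x → IsIso (π.stalkMap z') := fun z' hz' =>
    isIso_stalkMap_of_isIso_morphismRestrict π W z' (show π z' ∈ ((vanishingIdeal D).support : Set σ.X)ᶜ by
      rw [hsuppD]; exact hz')
  have hcoh' : 1 < Order.coheight (j (genericPoint C₁)) := by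
    haveI := hoffx _ (by rw [hgen]; exact hηx)
    rw [coheight_eq_of_isIso_stalkMap π, hgen]
    exact σ.coh
  have hdim3' : ∀ z' ∈ Set.range j, IsClosed ({z'} : Set X') →
      (maximalIdeal (X'.presheaf.stalk z')).spanFinrank = 3 := by
    intro z' hz' hzc
    haveI : IsRegularLocalRing (X'.presheaf.stalk z') := hX' z'
    by_cases hπz : π z' = x
    · have heq := hnear_eq z' hπz ((hsigma' z').mpr hz')
      subst heq
      exact hπ.spanFinrank_eq_three_of_isNear_point hd' hcc hccY hτ' hnear'
    · haveI := hoffx z' hπz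
      rw [spanFinrank_eq_of_isIso_stalkMap π z']
      have hπzc : IsClosed ({π z'} : Set σ.X) := by
        have h := π.isClosedMap _ hzc
        rwa [Set.image_singleton] at h
      have hπzS : π z' ∈ Set.range σ.i := by
        obtain ⟨c₁, rfl⟩ := hz'
        rw [hcomm_pt]; exact ⟨_, rfl⟩
      exact σ.dim3 _ hπzS hπzc
  have htau' : ∀ z' ∈ Set.range j, IsClosed ({z'} : Set X') → haveI := hX' z'; 2 ≤ stalkTau J' z' μ := by
    intro z' hz' hzc
    haveI : IsRegularLocalRing (X'.presheaf.stalk z') := hX' z'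
    by_cases hπz : π z' = x
    · have heq := hnear_eq z' hπz ((hsigma' z').mpr hz')
      subst heq
      have h := hπ.stalkTau_le_stalkTau_of_isNear_point (J := σ.J) hm hd' hcc hccY hτ' hnear'
      rw [hτ'] at h
      exact h
    · haveI := hoffx z' hπz
      haveI : IsRegularLocalRing (σ.X.presheaf.stalk (π z')) := hX (π z')
      rw [hJ'def, hπ.stalkTau_controlledTransform_of_not_mem σ.J μ μ (by rw [hsuppD]; exact hπz)]
      have hπzc : IsClosed ({π z'} : Set σ.X) := by
        have h := π.isClosedMap _ hzc
        rwa [Set.image_singleton] at h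
      have hπzS : π z' ∈ Set.range σ.i := by
        obtain ⟨c₁, rfl⟩ := hz'
        rw [hcomm_pt]; exact ⟨_, rfl⟩
      exact σ.tau _ hπzS hπzc
  refine ⟨⟨X', J', π ≫ σ.Φ, inferInstance, inferInstance, hX', hseq', C₁, j, hcj, hint₁, hnoeth₁, hqe₁, hdim₁,
    hnotClosed', hcoh', hsigma', htop', hdim3', htau'⟩, ?_⟩
  -- the measure drops
  change (∑ᶠ y, pointDelta C₁ y) < ∑ᶠ y, pointDelta σ.C y
  exact hlt ⟨c, rfl, hc⟩

end SigmaCurveState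

end CampaignW46

end Summit.ResolutionOfSingularities.ResolutionOfSingularities.Theorems

end
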